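import Summits.HubbardSuperconductivity.HubbardSuperconductivity.Theses.JosephsonMirror
import Summits.HubbardSuperconductivity.HubbardSuperconductivity.Theorems.BalabanIRBirEveryGroundStateSchur
import Summits.HubbardSuperconductivity.HubbardSuperconductivity.Theorems.BalabanIRBirEveryGroundStatePencil

/-!
# Sketch — crux-ideate round 1, ideator 1, crux `JmPairBridge` (stmt-HubbardSuperconductivity-2226)

First-lemma signatures for two crux idea cards (they only need to ELABORATE; nothing is proved here,
and nothing here is proposed to the tree):

* card `one-gap-capture` : `CaptureSqueeze` (abstract two-sided first-moment / Temple capture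
  inequality), `HubbardCapture` (its instance on the torus), `DoubleCommutatorBound`,
  `PairCommutatorBound`, the hypotheses `UniformLRO`, `TowerConvexity`, `SectorGap`,
  `WindowedBridge`, and the transfer shape `CaptureTransfer`.
* card `schur-bridge-some-to-every` : `SchurBridge` (abstract), `symSet`, `groundFloor`,
  `IrreducibleFloor`, `SomeBridge`, `EveryBridge`, `SchurSomeToEvery`, `SchurTransfer`,
  and the calibration `AttractiveDBridgeVanishes`.
-/

namespace Summit.HubbardSuperconductivity.HubbardSuperconductivity.Cruxes.JmPairBridge.Ideator1

open Literature.MathematicalPhysics.QuantumLattice Matrix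
open Summit.HubbardSuperconductivity.HubbardSuperconductivity.Theses.JosephsonMirror (JmPairBridge)

noncomputable section

/-- Fock index type of the `L × L` torus. -/
abbrev ι (L : ℕ) : Type := Finset (Orb (FermionTorus 2 L))

/-- `N_L = 2⌊(1-δ)L²/2⌋`. -/
abbrev NL (δ : ℝ) (L : ℕ) : ℕ := 2 * ⌊(1 - δ) * (L : ℝ) ^ 2 / 2⌋₊

/-- The pure Hubbard torus `t = 1`. -/
abbrev Hub (L : ℕ) (U : ℝ) : Matrix (ι L) (ι L) ℂ := hubbardTorus 2 L 1 U

/-- `Δ_d`. -/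
abbrev Δd (L : ℕ) [NeZero L] : Matrix (ι L) (ι L) ℂ := pairField dWaveFormFactor L

/-- sector ground energy `e_L(N) = minEnergyOn (szSector N 0)`. -/
abbrev eSec (L : ℕ) (U : ℝ) (N : ℕ) : ℝ := (Hub L U).minEnergyOn (szSector N 0)

/-! ## Card `one-gap-capture` -/

/-- **CaptureSqueeze** (abstract two-sided first-moment capture; Horsch–von der Linden / Temple).
`H` Hermitian, `Kp, Km, Kpp` are `H`-invariant subspaces ("sectors `N`, `N-2`, `N+2`"), `Δ` maps
`Kp → Km` and `Δᴴ` maps `Kp → Kpp`; `φ ∈ Kp` is a unit ground vector of `H|Kp`; `γ > 0` is a gap of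
`H|Km` above its ground floor. Then the part of `Δφ` NOT captured by the ground floor of `Km` is
controlled by the double commutator and two energy differences:
`γ (‖Δφ‖² − |⟨χ, Δφ⟩|²) ≤ Re⟨φ, [Δᴴ,[H,Δ]] φ⟩ + (e₊ − e₋)‖Δφ‖² + (e₊ − e₊₊)‖Δᴴφ‖²`
for the unit ground vector `χ := P_{G₋}Δφ/‖P_{G₋}Δφ‖` of `H|Km`. -/
def CaptureSqueeze : Prop :=
  ∀ (n : Type) [Fintype n] [DecidableEq n] (H Δ : Matrix n n ℂ) (Kp Km Kpp : Submodule ℂ (n → ℂ))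
    (γ : ℝ) (φ : n → ℂ),
    H.IsHermitian →
    (∀ v ∈ Km, H *ᵥ v ∈ Km) → (∀ v ∈ Kpp, H *ᵥ v ∈ Kpp) →
    (∀ v ∈ Kp, Δ *ᵥ v ∈ Km) → (∀ v ∈ Kp, Δᴴ *ᵥ v ∈ Kpp) →
    φ ∈ Kp → star φ ⬝ᵥ φ = 1 → H *ᵥ φ = ((H.minEnergyOn Kp : ℝ) : ℂ) • φ →
    0 < γ → Km ≠ ⊥ →
    (∀ v ∈ Km, (∀ χ ∈ Km, H *ᵥ χ = ((H.minEnergyOn Km : ℝ) : ℂ) • χ → star χ ⬝ᵥ v = 0) →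
        (H.minEnergyOn Km + γ) * (star v ⬝ᵥ v).re ≤ (star v ⬝ᵥ H *ᵥ v).re) →
    ∃ χ : n → ℂ, χ ∈ Km ∧ star χ ⬝ᵥ χ = 1 ∧ H *ᵥ χ = ((H.minEnergyOn Km : ℝ) : ℂ) • χ ∧
      γ * ((star (Δ *ᵥ φ) ⬝ᵥ (Δ *ᵥ φ)).re - ‖star χ ⬝ᵥ (Δ *ᵥ φ)‖ ^ 2) ≤
        (star φ ⬝ᵥ ((Δᴴ * (H * Δ - Δ * H) - (H * Δ - Δ * H) * Δᴴ) *ᵥ φ)).re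
          + (H.minEnergyOn Kp - H.minEnergyOn Km) * (star (Δ *ᵥ φ) ⬝ᵥ (Δ *ᵥ φ)).re
          + (H.minEnergyOn Kp - H.minEnergyOn Kpp) * (star (Δᴴ *ᵥ φ) ⬝ᵥ (Δᴴ *ᵥ φ)).re

/-- **DoubleCommutatorBound** (locality; provable now): `|⟨ψ, [Δ_dᴴ,[H,Δ_d]] ψ⟩| ≤ C (1+|U|) L² ‖ψ‖²`
uniformly in `L`, because `[H, P_y]` is supported within distance 2 of `y` and `[P_xᴴ, ·]` kills
disjoint supports (even fermionic monomials). -/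
def DoubleCommutatorBound : Prop :=
  ∃ C : ℝ, ∀ (L : ℕ) [NeZero L] (U : ℝ) (ψ : ι L → ℂ),
    |(star ψ ⬝ᵥ (((Δd L)ᴴ * (Hub L U * Δd L - Δd L * Hub L U)
        - (Hub L U * Δd L - Δd L * Hub L U) * (Δd L)ᴴ) *ᵥ ψ)).re|
      ≤ C * (1 + |U|) * (L : ℝ) ^ 2 * (star ψ ⬝ᵥ ψ).re

/-- **PairCommutatorBound** (provable now): `[Δ_d, Δ_dᴴ]` is a one-body operator of norm `O(L²)`:
`|‖Δ_dᴴψ‖² − ‖Δ_dψ‖²| ≤ C L² ‖ψ‖²`. -/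
def PairCommutatorBound : Prop :=
  ∃ C : ℝ, ∀ (L : ℕ) [NeZero L] (ψ : ι L → ℂ),
    |(star ((Δd L)ᴴ *ᵥ ψ) ⬝ᵥ ((Δd L)ᴴ *ᵥ ψ)).re - (star (Δd L *ᵥ ψ) ⬝ᵥ (Δd L *ᵥ ψ)).re|
      ≤ C * (L : ℝ) ^ 2 * (star ψ ⬝ᵥ ψ).re

/-- Hypothesis **UniformLRO** at `(U, δ)` with density `c` from side `L₀` on: every unit ground state
of `(N_L, S^z=0)` has `‖Δ_d φ‖² ≥ c L⁴` (the summit's matrix in uniform finite-volume form). -/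
def UniformLRO (U δ c : ℝ) (L₀ : ℕ) : Prop :=
  ∀ (L : ℕ) [NeZero L], Even L → L₀ ≤ L → ∀ φ : ι L → ℂ,
    IsGroundStateInSector (Hub L U) (NL δ L) 0 φ → star φ ⬝ᵥ φ = 1 →
      c * (L : ℝ) ^ 4 ≤ (star (Δd L *ᵥ φ) ⬝ᵥ (Δd L *ᵥ φ)).re

/-- Hypothesis **TowerConvexity** (charging bound): `2e(N_L) − e(N_L−2) − e(N_L+2) ≤ C₁ / L²`. -/
def TowerConvexity (U δ C₁ : ℝ) (L₀ : ℕ) : Prop :=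
  ∀ (L : ℕ), Even L → L₀ ≤ L →
    2 * eSec L U (NL δ L) - eSec L U (NL δ L - 2) - eSec L U (NL δ L + 2) ≤ C₁ / (L : ℝ) ^ 2

/-- Hypothesis **SectorGap** `Γ`: in the sector `(N_L − 2, S^z = 0)` every vector orthogonal to the
ground floor pays `Γ / L²`. (By `nodes-meet-the-grid` this is expected OFF a sparse resonant set of
`L` for a nodal witness, with room to spare — `Γ_L ~ L` there — and expected to FAIL on the resonant
progression; the card isolates that residue.) -/
def SectorGap (U δ Γ : ℝ) (L : ℕ) : Prop :=
  ∀ v ∈ szSector (Λ := FermionTorus 2 L) (NL δ L - 2) 0,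
    (∀ χ : ι L → ℂ, IsGroundStateInSector (Hub L U) (NL δ L - 2) 0 χ → star χ ⬝ᵥ v = 0) →
      (eSec L U (NL δ L - 2) + Γ / (L : ℝ) ^ 2) * (star v ⬝ᵥ v).re ≤ (star v ⬝ᵥ Hub L U *ᵥ v).re

/-- **WindowedBridge** (the robust intermediate): every unit ground state `φ` of `(N_L,0)` has
`Δ_d`-weight at least `a L⁴` on eigenvectors of the `(N_L−2,0)` sector with energy `≤ e + Γ/L²`.
Stated variationally: some unit `χ` in that sector with `Re⟨χ,Hχ⟩ ≤ e(N_L−2) + Γ/L²` has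
`|⟨χ, Δ_d φ⟩|² ≥ a L⁴`. (`Γ = 0` is exactly the crux `JmPairBridge` at `(U,δ)`.) -/
def WindowedBridge (U δ a Γ : ℝ) (L₀ : ℕ) : Prop :=
  ∀ (L : ℕ) [NeZero L], Even L → L₀ ≤ L → ∀ φ : ι L → ℂ,
    IsGroundStateInSector (Hub L U) (NL δ L) 0 φ → star φ ⬝ᵥ φ = 1 →
      ∃ χ : ι L → ℂ, χ ∈ szSector (Λ := FermionTorus 2 L) (NL δ L - 2) 0 ∧ star χ ⬝ᵥ χ = 1 ∧
        (star χ ⬝ᵥ Hub L U *ᵥ χ).re ≤ eSec L U (NL δ L - 2) + Γ / (L : ℝ) ^ 2 ∧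
        a * (L : ℝ) ^ 4 ≤ ‖star χ ⬝ᵥ (Δd L *ᵥ φ)‖ ^ 2

/-- **HubbardCapture**: the torus instance of `CaptureSqueeze` with the two locality bounds folded
in — for every unit ground state `φ` of `(N,0)` and a gap `γ` of `(N−2,0)`:
`γ (‖Δ_dφ‖² − |⟨χ,Δ_dφ⟩|²) ≤ C(1+|U|)L² + (e_N − e_{N−2})‖Δ_dφ‖² + (e_N − e_{N+2})‖Δ_dᴴφ‖²`. -/
def HubbardCapture : Prop :=
  ∃ C : ℝ, ∀ (L : ℕ) [NeZero L] (U γ : ℝ) (N : ℕ) (φ : ι L → ℂ), 2 ≤ N → 0 < γ →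
    IsGroundStateInSector (Hub L U) N 0 φ → star φ ⬝ᵥ φ = 1 →
    (∀ v ∈ szSector (Λ := FermionTorus 2 L) (N - 2) 0,
      (∀ χ : ι L → ℂ, IsGroundStateInSector (Hub L U) (N - 2) 0 χ → star χ ⬝ᵥ v = 0) →
        (eSec L U (N - 2) + γ) * (star v ⬝ᵥ v).re ≤ (star v ⬝ᵥ Hub L U *ᵥ v).re) →
    ∃ χ : ι L → ℂ, IsGroundStateInSector (Hub L U) (N - 2) 0 χ ∧ star χ ⬝ᵥ χ = 1 ∧
      γ * ((star (Δd L *ᵥ φ) ⬝ᵥ (Δd L *ᵥ φ)).re - ‖star χ ⬝ᵥ (Δd L *ᵥ φ)‖ ^ 2) ≤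
        C * (1 + |U|) * (L : ℝ) ^ 2
          + (eSec L U N - eSec L U (N - 2)) * (star (Δd L *ᵥ φ) ⬝ᵥ (Δd L *ᵥ φ)).re
          + (eSec L U N - eSec L U (N + 2)) * (star ((Δd L)ᴴ *ᵥ φ) ⬝ᵥ ((Δd L)ᴴ *ᵥ φ)).re

/-- **CaptureTransfer** (the line's composition, pure bookkeeping once `HubbardCapture` is in hand):
uniform LRO `c`, tower convexity `C₁` and a sector gap `Γ` beating the constants give the crux. -/
def CaptureTransfer : Prop :=
  HubbardCapture → PairCommutatorBound →
  ∀ (U δ c C₁ Γ : ℝ) (L₀ : ℕ), 0 < U → δ ∈ Set.Ioo (0 : ℝ) (1 / 2) → 0 < c →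
    UniformLRO U δ c L₀ → TowerConvexity U δ C₁ L₀ → (∀ L, Even L → L₀ ≤ L → SectorGap U δ Γ L) →
    (∃ a : ℝ, 0 < a ∧ ∃ L₁ : ℕ, ∀ (L : ℕ) [NeZero L], Even L → L₁ ≤ L → ∀ φ : ι L → ℂ,
      IsGroundStateInSector (Hub L U) (NL δ L) 0 φ → star φ ⬝ᵥ φ = 1 →
        ∃ χ : ι L → ℂ, IsGroundStateInSector (Hub L U) (NL δ L - 2) 0 χ ∧ star χ ⬝ᵥ χ = 1 ∧
          a * (L : ℝ) ^ 4 ≤ ‖star χ ⬝ᵥ (Δd L *ᵥ φ)‖ ^ 2) ∧ JmPairBridge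

/-- **WindowedFromLRO** (gap-free half, Markov): uniform LRO + tower convexity already give the
WINDOWED bridge with any window `Γ/L²` large against the constants — no gap hypothesis. -/
def WindowedFromLRO : Prop :=
  HubbardCapture → PairCommutatorBound →
  ∀ (U δ c C₁ : ℝ) (L₀ : ℕ), 0 < U → δ ∈ Set.Ioo (0 : ℝ) (1 / 2) → 0 < c →
    UniformLRO U δ c L₀ → TowerConvexity U δ C₁ L₀ →
      ∃ Γ : ℝ, ∃ L₁ : ℕ, WindowedBridge U δ (c / 2) Γ L₁

/-! ## Card `schur-bridge-some-to-every` -/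

/-- **SchurBridge** (abstract): unitary symmetries `X` preserving two floors `Gp, Gm` and scaling `Δ`
by unimodular phases make `C := P_{Gp} Δᴴ P_{Gm} Δ P_{Gp}` an intertwiner; if `Gp` is irreducible for
them, `‖P_{Gm} Δ φ‖²` is the same number `κ` for every unit `φ ∈ Gp` (stated without projections:
`κ` bounds every `|⟨χ,Δφ⟩|²`, `χ ∈ Gm` unit, and is attained). Uses `exists_scalar_of_irreducible`. -/
def SchurBridge : Prop :=
  ∀ (n : Type) [Fintype n] [DecidableEq n] (Δ : Matrix n n ℂ) (Gp Gm : Submodule ℂ (n → ℂ))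
    (S : Set (Matrix n n ℂ × ℂ)),
    (∀ p ∈ S, (p.1)ᴴ * p.1 = 1 ∧ (∀ v ∈ Gp, p.1 *ᵥ v ∈ Gp) ∧ (∀ v ∈ Gm, p.1 *ᵥ v ∈ Gm) ∧
        p.1 * Δ = p.2 • (Δ * p.1) ∧ ‖p.2‖ = 1) →
    (∀ K' : Submodule ℂ (n → ℂ), K' ≤ Gp → (∀ p ∈ S, ∀ v ∈ K', p.1 *ᵥ v ∈ K') → K' = ⊥ ∨ K' = Gp) →
    Gm ≠ ⊥ →
    ∃ κ : ℝ, ∀ φ ∈ Gp, star φ ⬝ᵥ φ = 1 →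
      (∀ χ ∈ Gm, star χ ⬝ᵥ χ = 1 → ‖star χ ⬝ᵥ (Δ *ᵥ φ)‖ ^ 2 ≤ κ) ∧
      (∃ χ ∈ Gm, star χ ⬝ᵥ χ = 1 ∧ ‖star χ ⬝ᵥ (Δ *ᵥ φ)‖ ^ 2 = κ)

/-- The unitary symmetries of the torus problem that preserve `N`, `S^z` and scale `Δ_d` by a phase
(contains translations, `D₄` — the rotation with phase `−1` —, `S^z`-rotations and the spin flip; and
any hidden symmetry with the same property). -/
def symSet (L : ℕ) [NeZero L] (U : ℝ) : Set (Matrix (ι L) (ι L) ℂ) :=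
  {X | Xᴴ * X = 1 ∧ X * Hub L U = Hub L U * X ∧
      X * (totalNumber : Matrix (ι L) (ι L) ℂ) = totalNumber * X ∧
      X * (HubbardWave0.spinZ : Matrix (ι L) (ι L) ℂ) = HubbardWave0.spinZ * X ∧
      ∃ ω : ℂ, ‖ω‖ = 1 ∧ X * Δd L = ω • (Δd L * X)}

/-- The ground floor of the sector `(N, S^z = 0)` as a subspace. -/
def groundFloor (L : ℕ) (U : ℝ) (N : ℕ) : Submodule ℂ (ι L → ℂ) :=
  szSector (Λ := FermionTorus 2 L) N 0 ⊓
    Module.End.eigenspace (Matrix.toLin' (Hub L U)) ((eSec L U N : ℝ) : ℂ)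

/-- **IrreducibleFloor**: the `(N,0)` ground floor has no proper nonzero `symSet`-invariant subspace. -/
def IrreducibleFloor (L : ℕ) [NeZero L] (U : ℝ) (N : ℕ) : Prop :=
  ∀ K' : Submodule ℂ (ι L → ℂ), K' ≤ groundFloor L U N →
    (∀ X ∈ symSet L U, ∀ v ∈ K', X *ᵥ v ∈ K') → K' = ⊥ ∨ K' = groundFloor L U N

/-- **SomeBridge**: ONE ground-floor pair with a macroscopic bridge (the shape of `JmInterchange`'s
conclusion). -/
def SomeBridge (U δ a : ℝ) (L : ℕ) [NeZero L] : Prop :=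
  ∃ φ χ : ι L → ℂ, IsGroundStateInSector (Hub L U) (NL δ L) 0 φ ∧ star φ ⬝ᵥ φ = 1 ∧
    IsGroundStateInSector (Hub L U) (NL δ L - 2) 0 χ ∧ star χ ⬝ᵥ χ = 1 ∧
    a * (L : ℝ) ^ 4 ≤ ‖star χ ⬝ᵥ (Δd L *ᵥ φ)‖ ^ 2

/-- **EveryBridge**: the crux's inner clause at side `L`. -/
def EveryBridge (U δ a : ℝ) (L : ℕ) [NeZero L] : Prop :=
  ∀ φ : ι L → ℂ, IsGroundStateInSector (Hub L U) (NL δ L) 0 φ → star φ ⬝ᵥ φ = 1 →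
    ∃ χ : ι L → ℂ, IsGroundStateInSector (Hub L U) (NL δ L - 2) 0 χ ∧ star χ ⬝ᵥ χ = 1 ∧
      a * (L : ℝ) ^ 4 ≤ ‖star χ ⬝ᵥ (Δd L *ᵥ φ)‖ ^ 2

/-- **SchurSomeToEvery** (first lemma of the card on the torus): irreducibility of the `(N_L,0)`
floor turns one macroscopic bridge into a bridge for EVERY ground state, same constant. -/
def SchurSomeToEvery : Prop :=
  ∀ (L : ℕ) [NeZero L] (U δ a : ℝ), IrreducibleFloor L U (NL δ L) → SomeBridge U δ a L →
    EveryBridge U δ a L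

/-- **SchurTransfer** (composition): some-bridge on an eventual range of even `L` at one coupling
where the floors are irreducible gives the crux. With `exists_coupling_forall_card_roots_le_hubbardTorus`
one coupling per open window is simultaneously non-exceptional for every `L`; what remains
Hubbard-specific is that non-exceptional floors are irreducible (no permanent inter-block partner). -/
def SchurTransfer : Prop :=
  SchurSomeToEvery →
  ∀ (U δ a : ℝ) (L₀ : ℕ), 0 < U → δ ∈ Set.Ioo (0 : ℝ) (1 / 2) → 0 < a →
    (∀ (L : ℕ) [NeZero L], Even L → L₀ ≤ L → IrreducibleFloor L U (NL δ L) ∧ SomeBridge U δ a L) →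
    JmPairBridge

/-- **AttractiveDBridgeVanishes** (calibration, provable over `LiebSpinReflection` /
`lieb_attractive_holds`): for `U < 0` both floors are simple and carry the trivial character of the
90° rotation, so the `B₁g` operator `Δ_d` has ZERO matrix element between them at every `L`. -/
def AttractiveDBridgeVanishes : Prop :=
  ∀ (L : ℕ) [NeZero L] (U : ℝ) (N : ℕ), U < 0 → 2 ≤ N → ∀ φ χ : ι L → ℂ,
    IsGroundStateInSector (Hub L U) N 0 φ → IsGroundStateInSector (Hub L U) (N - 2) 0 χ →
      star χ ⬝ᵥ (Δd L *ᵥ φ) = 0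

-- the in-tree lemmas the cards lean on (existence check)
#check @Summit.HubbardSuperconductivity.HubbardSuperconductivity.Theorems.exists_scalar_of_irreducible
#check @Summit.HubbardSuperconductivity.HubbardSuperconductivity.Theorems.exists_coupling_forall_card_roots_le_hubbardTorus
#check @JmPairBridge

end

end Summit.HubbardSuperconductivity.HubbardSuperconductivity.Cruxes.JmPairBridge.Ideator1
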